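import Summits.CriticalPhenomena.SAWScalingLimit.Theorems.SAWDevelopingMapObservableToSLETypeLadderCarvedReductionSqueezeStrips
import Summits.CriticalPhenomena.SAWScalingLimit.Theorems.SAWDevelopingMapObservableToSLETypeLadderCarvedReductionSqueezeZoneBulk
import HarnessLib

/-!
# The zones `Z(σ, c)` and regions `X(t)` of the squeeze and their `outerSeq` hypotheses (piece
# (T-A′₂F zones) of stub T-A′₂F `stub_carvedReduction_squeezeGeometry_domainsCoreF`)

Crux `SAWDevelopingMap.ObservableToSLE` (stmt-CriticalPhenomena-10472), line `six-class-type-ladder`,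
stub T-A′₂F `stub_carvedReduction_squeezeGeometry_domainsCoreF`.  Landing target:
`Summits/CriticalPhenomena/SAWScalingLimit/Theorems/SAWDevelopingMapObservableToSLETypeLadderCarvedReductionSqueezeZonesDef.lean`.

`zoneAt P ρ Ksp Bd cell conn K z∞ σ c := sideZone₀ σ ∪ sideZone₁ σ ∪ collarZone K z∞ c` and
`XAt Ω P ρ t := Ω ∪ ⋃ᵢ pathComponentIn (gateV Pᵢ ρ t) (Pᵢ + (ρ/16) i)`; the outer sequence uses
`Z_n = zoneAt (4εₙ) cₙ`, `Z'_n = zoneAt (2εₙ) (cₙ/2)`, `X_n = XAt (4εₙ)`.  This file proves the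
hypotheses of `outerSeq` for them from the elementary data of the super-domain and the bulk:
openness and monotonicity, `Disjoint Ω (closure Z)` (`disjoint_closure_zoneAt`), the attachment
(`zoneAt_attached`: each side zone is connected and contains a box point off `E`, the collar is
connected through `z∞ ∉ E`), the margin `dist (Z(2σ, c), E ∖ Z(σ, c/2)) ≥ min σ (c/2)`
(`le_dist_zoneAt`), the facts on `X(t)` (`XAt_subset`, `isPreconnected_XAt`,
`disjoint_XAt_closure_zoneAt`), and the local boundary structure in this vocabulary
(`lbs_zoneAt`).
Registered carrier: `stub_carvedReduction_zonesDef`.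
-/

noncomputable section

open scoped Topology
open Filter Set Metric
open Literature.Probability.RandomPlanarGeometry

namespace Summit.CriticalPhenomena.SAWScalingLimit.Theorems.ObservableToSLE.TypeLadder

/-- **The zone at shrink `σ` and collar distance `c`**: both side zones and the collar. -/
def zoneAt {N : ℕ} (P : Fin 2 → ℂ) (ρ : ℝ) (Ksp Bd : Fin 2 → Set ℂ) (cell conn : Fin 2 → Fin N → ℂ × ℝ)
    (K : Set ℂ) (zf : ℂ) (σ c : ℝ) : Set ℂ :=
  (sideZone (P 0) ρ (Ksp 0) (Bd 0) (cell 0) (conn 0) σ ∪ sideZone (P 1) ρ (Ksp 1) (Bd 1) (cell 1) (conn 1) σ) ∪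
    collarZone K zf c

/-- **The region `X(t)`**: the bulk and the path components of the base points in the wide window
regions at depth `t`. -/
def XAt (Ω : Set ℂ) (P : Fin 2 → ℂ) (ρ t : ℝ) : Set ℂ :=
  Ω ∪ ⋃ i : Fin 2, pathComponentIn (gateV (P i) ρ t) (P i + ((ρ / 16 : ℝ) : ℂ) * Complex.I)

section Zones

variable {N : ℕ} {P : Fin 2 → ℂ} {ρ : ℝ} {Ksp Bd : Fin 2 → Set ℂ} {cell conn : Fin 2 → Fin N → ℂ × ℝ}
  {K : Set ℂ} {zf : ℂ} {Ω E : Set ℂ}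

/-- The zone is open. -/
theorem isOpen_zoneAt (σ c : ℝ) : IsOpen (zoneAt P ρ Ksp Bd cell conn K zf σ c) :=
  ((isOpen_sideZone σ).union (isOpen_sideZone σ)).union (isOpen_collarZone c)

/-- The side zones decrease (weakly) in the shrink parameter. -/
theorem sideZone_antitone {P₀ : ℂ} {Ksp₀ B₀ : Set ℂ} {cell₀ conn₀ : Fin N → ℂ × ℝ} {s s' : ℝ} (h : s ≤ s') :
    sideZone P₀ ρ Ksp₀ B₀ cell₀ conn₀ s' ⊆ sideZone P₀ ρ Ksp₀ B₀ cell₀ conn₀ s := by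
  rcases h.lt_or_eq with h | rfl
  · exact sideZone_mono h
  · exact Subset.rfl

/-- The zones increase as the shrink and the collar distance decrease. -/
theorem zoneAt_mono {σ σ' c c' : ℝ} (hσ : σ ≤ σ') (hc : c ≤ c') :
    zoneAt P ρ Ksp Bd cell conn K zf σ' c' ⊆ zoneAt P ρ Ksp Bd cell conn K zf σ c :=
  union_subset_union (union_subset_union (sideZone_antitone hσ) (sideZone_antitone hσ)) (collarZone_mono hc)

/-- **`Ω` misses the closure of the zone** (`σ, c > 0`, `Ω ⊆ K`, unshrunk side zones off `Ω`). -/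
theorem disjoint_closure_zoneAt (hΩ0 : ∀ i, Disjoint Ω (sideZone (P i) ρ (Ksp i) (Bd i) (cell i) (conn i) 0))
    (hΩK : Ω ⊆ K) {σ c : ℝ} (hσ : 0 < σ) (hc : 0 < c) :
    Disjoint Ω (closure (zoneAt P ρ Ksp Bd cell conn K zf σ c ∩ E)) := by
  rw [disjoint_left]
  intro w hw hwcl
  have h1 := closure_mono inter_subset_left hwcl
  rw [zoneAt, closure_union, closure_union] at h1
  rcases h1 with (h | h) | h
  · have := le_dist_of_mem_closure_sideZone (hΩ0 0) h hw; rw [dist_self] at this; linarith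
  · have := le_dist_of_mem_closure_sideZone (hΩ0 1) h hw; rw [dist_self] at this; linarith
  · have h2 := le_infDist_of_mem_closure_collarZone h
    rw [infDist_zero_of_mem (hΩK hw)] at h2
    linarith

/-- The box point `P - (3ρ/512) i` lies in the `σ`-shrunken lower half-window (`σ ≤ ρ/256`) and in
the frame box. -/
theorem boxPoint_mem {P₀ : ℂ} (hρ : 0 < ρ) {σ : ℝ} (hσ : σ ≤ ρ / 256) :
    P₀ - ((3 * ρ / 512 : ℝ) : ℂ) * Complex.I ∈ lowerWin P₀ ρ σ ∧ P₀ - ((3 * ρ / 512 : ℝ) : ℂ) * Complex.I ∈ gateRect P₀ ρ := by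
  refine ⟨⟨?_, ?_⟩, ?_, ?_, ?_⟩
  · show (P₀ - ((3 * ρ / 512 : ℝ) : ℂ) * Complex.I).im < P₀.im - σ
    simp; linarith
  · rw [mem_ball, dist_eq_norm, sub_sub_cancel_left, norm_neg, norm_mul, Complex.norm_real, Complex.norm_I, mul_one,
      Real.norm_eq_abs, abs_of_pos (by positivity)]
    linarith
  · simp; positivity
  · simp; linarith
  · simp; positivity

/-- **ATTACHMENT**: every point of the zone in `E` lies in an open preconnected piece of the zone
leaving `E` — the side zones (connected, containing a box point, boxes off `E`) and the collar
(through `z∞ ∉ E`). -/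
theorem zoneAt_attached (hρ : 0 < ρ) {σ c : ℝ} (hσ : σ ≤ ρ / 256)
    (hside : ∀ i, IsConnected (sideZone (P i) ρ (Ksp i) (Bd i) (cell i) (conn i) σ))
    (hbox : ∀ i (z : ℂ), z ∈ gateRect (P i) ρ → z ∉ E) (hzf : c < infDist zf K) (hzfE : zf ∉ E) :
    ∀ z ∈ zoneAt P ρ Ksp Bd cell conn K zf σ c ∩ E, ∃ C : Set ℂ, IsOpen C ∧ IsPreconnected C ∧ z ∈ C ∧
      C ⊆ zoneAt P ρ Ksp Bd cell conn K zf σ c ∧ (C \ E).Nonempty := by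
  rintro z ⟨hz, -⟩
  rcases hz with (h | h) | h
  · refine ⟨_, isOpen_sideZone σ, (hside 0).isPreconnected, h, fun w hw => Or.inl (Or.inl hw), ?_⟩
    exact ⟨_, Or.inl (Or.inl (Or.inl (boxPoint_mem hρ hσ).1)), hbox 0 _ (boxPoint_mem hρ hσ).2⟩
  · refine ⟨_, isOpen_sideZone σ, (hside 1).isPreconnected, h, fun w hw => Or.inl (Or.inr hw), ?_⟩
    exact ⟨_, Or.inl (Or.inl (Or.inl (boxPoint_mem hρ hσ).1)), hbox 1 _ (boxPoint_mem hρ hσ).2⟩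
  · refine ⟨_, isOpen_collarZone c, isPreconnected_collarZone c, h, fun w hw => Or.inr hw, zf, ?_, hzfE⟩
    exact mem_connectedComponentIn (show c < infDist zf K from hzf)

/-- **THE MARGIN**: `dist (Z(2σ, c) ∩ E, E ∖ Z(σ, c/2)) ≥ min σ (c/2)`. -/
theorem le_dist_zoneAt (σ c : ℝ) :
    ∀ a ∈ zoneAt P ρ Ksp Bd cell conn K zf (2 * σ) c ∩ E, ∀ b ∈ E \ zoneAt P ρ Ksp Bd cell conn K zf σ (c / 2),
      min σ (c / 2) ≤ dist a b := by
  rintro a ⟨ha, -⟩ b ⟨-, hb⟩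
  by_contra hlt
  push Not at hlt
  refine hb ?_
  rcases ha with (h | h) | h
  · exact Or.inl (Or.inl (sideZone_of_dist_lt h (by rw [dist_comm]; linarith [min_le_left σ (c / 2)])))
  · exact Or.inl (Or.inr (sideZone_of_dist_lt h (by rw [dist_comm]; linarith [min_le_left σ (c / 2)])))
  · exact Or.inr (mem_collarZone_half_of_dist_lt h (hlt.trans_le (min_le_right _ _)))

/-! ### The regions `X(t)` -/

/-- `X(t) ⊆ E` when the bulk and the path components of the base points lie in `E`. -/
theorem XAt_subset {t : ℝ} (hΩE : Ω ⊆ E)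
    (hVE : ∀ i, pathComponentIn (gateV (P i) ρ t) (P i + ((ρ / 16 : ℝ) : ℂ) * Complex.I) ⊆ E) :
    XAt Ω P ρ t ⊆ E :=
  union_subset hΩE (iUnion_subset hVE)

/-- The base point `P + (ρ/16) i` lies in the open upper half-window of radius `ρ/2`. -/
theorem base_mem_window {P₀ : ℂ} (hρ : 0 < ρ) :
    P₀ + ((ρ / 16 : ℝ) : ℂ) * Complex.I ∈ {z : ℂ | P₀.im < z.im} ∩ ball P₀ (ρ / 2) := by
  refine ⟨?_, ?_⟩
  · show P₀.im < (P₀ + ((ρ / 16 : ℝ) : ℂ) * Complex.I).im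
    simp; positivity
  · rw [mem_ball, dist_eq_norm, add_sub_cancel_left, norm_mul, Complex.norm_real, Complex.norm_I, mul_one,
      Real.norm_eq_abs, abs_of_pos (by positivity)]
    linarith

/-- `X(t)` is preconnected (`Ω` connected containing the windows, `t > 0`). -/
theorem isPreconnected_XAt (hρ : 0 < ρ) {t : ℝ} (ht : 0 < t) (hΩc : IsConnected Ω)
    (hwin : ∀ i, {z : ℂ | (P i).im < z.im} ∩ ball (P i) (ρ / 2) ⊆ Ω) : IsPreconnected (XAt Ω P ρ t) := by
  obtain ⟨o, ho⟩ := hΩc.nonempty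
  refine isPreconnected_of_forall o fun y hy => ?_
  rcases hy with hy | hy
  · exact ⟨Ω, subset_union_left, ho, hy, hΩc.isPreconnected⟩
  · rw [mem_iUnion] at hy
    obtain ⟨i, hy⟩ := hy
    have hb : P i + ((ρ / 16 : ℝ) : ℂ) * Complex.I ∈ gateV (P i) ρ t := gateW_subset_gateV hρ (base_mem_gateW hρ ht)
    refine ⟨Ω ∪ pathComponentIn (gateV (P i) ρ t) (P i + ((ρ / 16 : ℝ) : ℂ) * Complex.I),
      union_subset subset_union_left fun w hw => Or.inr (mem_iUnion.2 ⟨i, hw⟩), Or.inl ho, Or.inr hy, ?_⟩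
    exact hΩc.isPreconnected.union _ (hwin i (base_mem_window hρ)) (mem_pathComponentIn_self hb)
      (isPathConnected_pathComponentIn hb).isConnected.isPreconnected

/-- **`X(t)` misses the closure of the zone `Z(σ, c)`** for `0 < t ≤ σ`, `t ≤ ρ/4`, `c > 0`. -/
theorem disjoint_XAt_closure_zoneAt (hΩ0 : ∀ i, Disjoint Ω (sideZone (P i) ρ (Ksp i) (Bd i) (cell i) (conn i) 0))
    (hΩK : Ω ⊆ K) (hwin : ∀ i, {z : ℂ | (P i).im < z.im} ∩ ball (P i) (ρ / 2) ⊆ Ω)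
    (hballK : ∀ i, ball (P i) (ρ / 2) ⊆ K) (hρ : 0 < ρ) {σ c t : ℝ} (ht : 0 < t) (hts : t ≤ σ) (htρ : t ≤ ρ / 4)
    (hc : 0 < c) : Disjoint (XAt Ω P ρ t) (closure (zoneAt P ρ Ksp Bd cell conn K zf σ c ∩ E)) := by
  rw [disjoint_left]
  intro w hw hwcl
  rcases hw with hw | hw
  · exact disjoint_left.1 (disjoint_closure_zoneAt hΩ0 hΩK (by linarith) hc) hw hwcl
  · rw [mem_iUnion] at hw
    obtain ⟨i, hw⟩ := hw
    have hwV : w ∈ gateV (P i) ρ t := pathComponentIn_subset hw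
    have h1 := closure_mono inter_subset_left hwcl
    rw [zoneAt, closure_union, closure_union] at h1
    rcases h1 with (h | h) | h
    · exact disjoint_left.1 (gateV_disjoint_closure_sideZone (hΩ0 0) (hwin i) ht hts htρ) hwV h
    · exact disjoint_left.1 (gateV_disjoint_closure_sideZone (hΩ0 1) (hwin i) ht hts htρ) hwV h
    · exact disjoint_left.1 (gateV_disjoint_closure_collarZone hc (hballK i) hρ.le) hwV h

/-- The narrow strip lies in `X(t)` (`0 < t ≤ ρ/128`). -/
theorem gateW_subset_XAt (hρ : 0 < ρ) {t : ℝ} (ht : 0 < t) (htρ : t ≤ ρ / 128) (i : Fin 2) :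
    gateW (P i) ρ t ⊆ XAt Ω P ρ t := fun _ hz =>
  Or.inr (mem_iUnion.2 ⟨i, (joinedIn_gateV hρ ht htρ hz).symm⟩)

/-- **THE LOCAL BOUNDARY STRUCTURE in the vocabulary of `zoneAt`/`XAt`**
(`localBoundaryStructure`): `0 < σ ≤ ρ/512`, `0 < c ≤ c₀`. -/
theorem lbs_zoneAt {J : JordanDomain} {L F : Fin 2 → Set ℂ} {xx : Fin 2 → Fin 2 → ℂ} (hρ : 0 < ρ)
    (hEJ : E ⊆ J.carrier) (hfrE : frontier E ⊆ L 0 ∪ L 1 ∪ frontier J.carrier)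
    (hL : ∀ i, L i ⊆ gateO (Bd i) (F i) (P i) ρ ∪
      (segment ℝ (P i - ((ρ / 64 : ℝ) : ℂ) - ((ρ / 128 : ℝ) : ℂ) * Complex.I) (P i - ((ρ / 64 : ℝ) : ℂ)) ∪
        segment ℝ (P i - ((ρ / 64 : ℝ) : ℂ)) (P i + ((ρ / 64 : ℝ) : ℂ)) ∪
        segment ℝ (P i + ((ρ / 64 : ℝ) : ℂ)) (P i + ((ρ / 64 : ℝ) : ℂ) - ((ρ / 128 : ℝ) : ℂ) * Complex.I)) ∪
      {xx i 0, xx i 1})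
    (hxx : ∀ i k, xx i k ∈ frontier J.carrier) (hK : IsCompact K) (hKne : K.Nonempty) (hKc : IsPreconnected Kᶜ)
    (hzf : zf ∉ K) (hKJ : K ⊆ J.carrier) (hF : ∀ i, F i ⊆ J.carrier) (hFK : ∀ i, Disjoint (closure (F i)) K)
    (hbox : ∀ i (z : ℂ), |z.re - (P i).re| ≤ ρ / 64 → (P i).im - ρ / 128 ≤ z.im → z.im ≤ (P i).im → z ∉ E) :
    ∃ c₀ > (0 : ℝ), ∀ (σ c : ℝ), 0 < σ → σ ≤ ρ / 512 → 0 < c → c ≤ c₀ →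
      ∀ p ∈ frontier E, ∃ Nb ∈ 𝓝 p,
        Nb ∩ E ⊆ zoneAt P ρ Ksp Bd cell conn K zf σ c ∨ Nb ∩ E ⊆ XAt Ω P ρ (2 * σ) := by
  obtain ⟨c₀, hc₀, h⟩ := localBoundaryStructure Ksp cell conn hρ hEJ hfrE hL hxx hK hKne hKc hzf hKJ hF hFK hbox
  refine ⟨c₀, hc₀, fun σ c hσ hσρ hc hcc₀ p hp => ?_⟩
  obtain ⟨Nb, hNb, halt⟩ := h σ c hσ (by linarith) hc hcc₀ p hp
  refine ⟨Nb, hNb, halt.imp (fun h1 => h1) fun ⟨i, hi⟩ => hi.trans (gateW_subset_XAt hρ (by linarith) (by linarith) i)⟩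

end Zones

/-- **Registered carrier `stub_carvedReduction_zonesDef`** (crux item stmt-CriticalPhenomena-10472,
stub T-A′₂F `stub_carvedReduction_squeezeGeometry_domainsCoreF`, piece THE ZONES): the base point
`P + (ρ/16) i` lies in the open upper half-window of radius `ρ/2`. -/
theorem stub_carvedReduction_zonesDef :
    ∀ (P : ℂ) (ρ : ℝ), 0 < ρ → P + ((ρ / 16 : ℝ) : ℂ) * Complex.I ∈ {z : ℂ | P.im < z.im} ∩ ball P (ρ / 2) :=
  fun _ _ hρ => base_mem_window hρ

end Summit.CriticalPhenomena.SAWScalingLimit.Theorems.ObservableToSLE.TypeLadder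

end
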